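import Summits.HodgeConjecture.HodgeConjecture.Cruxes.BlochSeedDiscOne.FineDoorRing2

/-!
# FineMassU4 — LEMMA B₄: the N-SIDE MASS ROW of an N u⁴ cell behind the mass-form fine door, every shell and every height
# (hsemireg-sheaf8-1 g7; director R19.765 ruling «v4.4 := v4.3 + DMassN» CONDITIONAL YES, condition (b) = this typed leaf)

Token: line stmt-HodgeConjecture-18881 Cruxes/BlochSeedDiscOne/Lines/birth.lean 814a6a70c14e831a stub_rung_pad4_seedAt.
LETTER-MODEL BOOKKEEPING ONLY (`DepthBoundA4.Design`).  Letters ≠ displays ≠ sheaves ≠ SEED; nothing here is proved toward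
HC ∕ HC_CM ∕ HC_AV ∕ №4 ∕ 26512 ∕ 18881 ∕ H2.  No `axiom` ∕ `sorry` ∕ `instance` ∕ `decide` ∕ `native_decide`; the height `h` is FREE; no ring hypothesis.

THE DOOR: `FineDoorRing2.DMassN` (§5 there; = `C4StabilitySpec` § DMass ROW D-MASS-N, THEOREM P lower level behind (H2)): for every supported
N cell `ν`, block `g < j` and VALID `(λ, μ)`, `m_N(ν) ≤ capN = Σ_{(p,m) ∈ D.P counted} homDim p ν · m`.  It is NOT part of the statement of
record v4.3 (which carries the P rows `RuleDPFine`); the director's ruling R19.765 makes it v4.4 on (a) a ×2 pen necessity sign-off and (b) this leaf.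

## What is proved (kernel)
* §1 alphabet: an AXIS letter one null step below a UNIT `u` lies on `u`'s axis and `annU u` annihilates the step (`annU_annihilates_axis_below`);
  its `kFactor` is `col − 1` (`kFactor_axis_below_unit`).
* §2 validity of the two functionals used: (`e_A*` on a unit slot `g`, `annU` on a unit slot `j`), both orientations (`fdetects_eA_annU_units`,
  `fdetects_annU_eA_units`) — values `−|β_j|² = −1` and `−β_g·conj β_j`.
* §3 **LEMMA B₄** `u4_mass_le_hookMass`: under `OnAlphabet h ∧ Disj ∧ DMassN` and the displayed P-side regime «every hub-free supported P cell
  is an AXIS cell» (a THEOREM behind the fine door under (M1)ₛ — `FineAxisLift.hubfreeP_axis_of_noHubfreeN` — or a door fact of the cascade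
  worlds), every supported N cell `ν` with all co-levels `1` (a u⁴ cell) satisfies, for EVERY slot `g`,
  `m_N(ν) ≤ hookMass D ν g := Σ_{(p,m) ∈ D.P : p = ν off g, p g AXIS one null step below ν g} kFactor (p g) (ν g) · m`.
  (Counted servers of the row are g-legs, j-legs off the axis line of `ν j` and (r2a) partners with such a `j`-step; a letter one null step below a
  unit and off its axis line is OFF-AXIS, so under the regime only the axis g-legs carry P mass.)  With `kFactor = col − 1` this is the row
  «m_N(ν) ≤ Σ_k (k − 1)·m_P(ν[g ↦ axis letter of co-level k])» of the bus line RESULT-7; summing over the u⁴ cells and the four slots gives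
  4·M_N(u⁴) ≤ Σ_k (k − 1)·M_P(co-level-k axis hooks) (pen, memo) — at S ≤ 48 (BOXCAP: only the k = 2 hook alive) M_N(u⁴) ≤ M_P(Auuu)∕4.
-/

set_option linter.dupNamespace false
set_option autoImplicit false

namespace Summit.HodgeConjecture.HodgeConjecture.Cruxes.BlochSeedDiscOne.FineMassU4

open Summit.HodgeConjecture.HodgeConjecture.Cruxes.BlochSeedDiscOne.DepthBoundA4
open Summit.HodgeConjecture.HodgeConjecture.Cruxes.BlochSeedDiscOne.LeggedFloor (NullStep Disj mem_supp_of_memP mem_supp_of_memN)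
open Summit.HodgeConjecture.HodgeConjecture.Cruxes.BlochSeedDiscOne.FineDoorRing2
  (intG blockM₁ blockM₂ lineVec gPairing Annihilates FDetects DMassValid IsLeg IsR2a DMassCounts eA annU kFactor CellLe homDim capN DMassN)

/-! ## §1 Alphabet: axis letters below a unit -/

theorem col_nonneg (ℓ : Letter) : 0 ≤ ℓ.colevel := by unfold Letter.colevel; positivity

theorem level_eq {h : ℤ} {ℓ : Letter} (hℓ : ℓ.OnAlphabet h) : ℓ.a = h - ℓ.colevel := by
  have h1 := hℓ.1; unfold Letter.height at h1; unfold Letter.colevel; omega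

theorem beta_ne_zero_of_col_ne_zero {ℓ : Letter} (hc : ℓ.colevel ≠ 0) : ℓ.beta ≠ 0 := by
  intro hb
  unfold Letter.beta at hb
  have hx : ℓ.x = 0 := by have := congrArg Zsqrtd.re hb; simpa using this
  have hy : ℓ.y = 0 := by have := congrArg Zsqrtd.im hb; simpa using this
  apply hc; unfold Letter.colevel; rw [hx, hy]; simp

/-- a unit of the alphabet: exactly one of `x, y` is `±1`, the other `0`. -/
theorem unit_coords {u : Letter} (h1 : u.colevel = 1) :
    (u.x = 0 ∧ (u.y = 1 ∨ u.y = -1)) ∨ (u.y = 0 ∧ (u.x = 1 ∨ u.x = -1)) := by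
  unfold Letter.colevel at h1
  rcases (abs_nonneg u.x).lt_or_eq with hlt | heq
  · have hy0 : |u.y| = 0 := by have := abs_nonneg u.y; omega
    have hx1 : |u.x| = 1 := by omega
    right; refine ⟨abs_eq_zero.mp hy0, ?_⟩
    rcases (abs_eq zero_le_one).mp hx1 with h | h
    · left; exact h
    · right; exact h
  · have hx0 : u.x = 0 := abs_eq_zero.mp heq.symm
    have hy1 : |u.y| = 1 := by omega
    left; refine ⟨hx0, ?_⟩
    rcases (abs_eq zero_le_one).mp hy1 with h | h
    · left; exact h
    · right; exact h

/-- **an AXIS letter one null step below a unit lies on the unit's axis**: with `k = col L`, `(L.x, L.y) = (k·u.x, k·u.y)`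
and the step has `Δa = k − 1`. -/
theorem axis_below_unit {h : ℤ} {L u : Letter} (hL : L.OnAlphabet h) (hu : u.OnAlphabet h) (hu1 : u.colevel = 1)
    (hax : L.x * L.y = 0) (hn : NullStep L u) :
    L.x = L.colevel * u.x ∧ L.y = L.colevel * u.y ∧ u.a - L.a = L.colevel - 1 := by
  have hLa := level_eq hL; have hua := level_eq hu
  rw [hu1] at hua
  obtain ⟨hlt, hsq⟩ := hn
  have hda : u.a - L.a = L.colevel - 1 := by rw [hLa, hua]; ring
  rw [hda] at hsq
  unfold Letter.colevel at hsq hda ⊢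
  -- |L|² = (|L.x| + |L.y|)² for an axis letter, |u|² = 1 for a unit
  have hLsq : L.x * L.x + L.y * L.y = (|L.x| + |L.y|) * (|L.x| + |L.y|) := by
    rcases mul_eq_zero.mp hax with h0 | h0 <;> · rw [h0]; simp [← sq, sq_abs]
  have hux := sq_abs u.x; have huy := sq_abs u.y; have hLx := sq_abs L.x; have hLy := sq_abs L.y
  have hu' : (u.x = 0 ∧ (u.y = 1 ∨ u.y = -1)) ∨ (u.y = 0 ∧ (u.x = 1 ∨ u.x = -1)) := unit_coords hu1
  -- the key linear identity  u·L = |L.x| + |L.y|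
  have key : u.x * L.x + u.y * L.y = |L.x| + |L.y| := by
    have husq : u.x * u.x + u.y * u.y = 1 := by
      rcases hu' with ⟨h0, h1 | h1⟩ | ⟨h0, h1 | h1⟩ <;> · rw [h0, h1]; norm_num
    nlinarith [hsq, hLsq, husq]
  have ax := le_abs_self L.x; have ay := le_abs_self L.y; have nx := neg_abs_le L.x; have ny := neg_abs_le L.y
  have px := abs_nonneg L.x; have py := abs_nonneg L.y
  rcases hu' with ⟨h0, h1 | h1⟩ | ⟨h0, h1 | h1⟩
  · -- u = (0, 1): L.y = |L.x| + |L.y| ⇒ L.x = 0, L.y = |L.y|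
    rw [h0, h1] at key ⊢
    have hx0 : |L.x| = 0 := by linarith
    have hLx0 : L.x = 0 := abs_eq_zero.mp hx0
    refine ⟨by rw [hLx0]; ring, by rw [hx0]; linarith, hda⟩
  · rw [h0, h1] at key ⊢
    have hx0 : |L.x| = 0 := by linarith
    have hLx0 : L.x = 0 := abs_eq_zero.mp hx0
    refine ⟨by rw [hLx0]; ring, by rw [hx0]; linarith, hda⟩
  · rw [h0, h1] at key ⊢
    have hy0 : |L.y| = 0 := by linarith
    have hLy0 : L.y = 0 := abs_eq_zero.mp hy0
    refine ⟨by rw [hy0]; linarith, by rw [hLy0]; ring, hda⟩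
  · rw [h0, h1] at key ⊢
    have hy0 : |L.y| = 0 := by linarith
    have hLy0 : L.y = 0 := abs_eq_zero.mp hy0
    refine ⟨by rw [hy0]; linarith, by rw [hLy0]; ring, hda⟩

/-- `annU u` annihilates the null step from an AXIS letter below the unit `u` up to `u` (the step runs along `u`'s axis). -/
theorem annU_annihilates_axis_below {h : ℤ} {L u : Letter} (hL : L.OnAlphabet h) (hu : u.OnAlphabet h) (hu1 : u.colevel = 1)
    (hax : L.x * L.y = 0) (hn : NullStep L u) : Annihilates (annU u) L u := by
  obtain ⟨hx, hy, hda⟩ := axis_below_unit hL hu hu1 hax hn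
  unfold Annihilates gPairing lineVec annU intG Letter.beta
  simp only [Matrix.cons_val_zero, Matrix.cons_val_one]
  refine Zsqrtd.ext_iff.mpr ⟨?_, ?_⟩
  · simp [Zsqrtd.re_mul, Zsqrtd.re_add, Zsqrtd.re_neg, Zsqrtd.re_sub]
    rw [hda, hx]; ring
  · simp [Zsqrtd.im_mul, Zsqrtd.im_add, Zsqrtd.im_neg, Zsqrtd.im_sub]
    rw [hda, hy]; ring

/-- contrapositive: a letter one null step below a unit `u` whose step is NOT annihilated by `annU u` is OFF-AXIS. -/
theorem offAxis_of_not_annihilated {h : ℤ} {L u : Letter} (hL : L.OnAlphabet h) (hu : u.OnAlphabet h) (hu1 : u.colevel = 1)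
    (hn : NullStep L u) (hna : ¬ Annihilates (annU u) L u) : L.x * L.y ≠ 0 :=
  fun hax => hna (annU_annihilates_axis_below hL hu hu1 hax hn)

/-- the `kFactor` (= `h⁰` weight under the canonical lift) of the step from an axis letter of co-level `k` up to the unit above it is `k − 1`. -/
theorem kFactor_axis_below_unit {h : ℤ} {L u : Letter} (hL : L.OnAlphabet h) (hu : u.OnAlphabet h) (hu1 : u.colevel = 1)
    (hax : L.x * L.y = 0) (hn : NullStep L u) : kFactor L u = L.colevel - 1 := by
  obtain ⟨hx, hy, hda⟩ := axis_below_unit hL hu hu1 hax hn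
  have hlt := hn.1
  have hsq := hn.2
  have hk : 1 ≤ L.colevel - 1 := by omega
  unfold kFactor
  rw [if_neg (by intro hc; omega), if_pos hsq]
  -- Δx = (1 − k)·u.x, Δy = (1 − k)·u.y with (u.x, u.y) a unit vector
  have hdx : u.x - L.x = -(L.colevel - 1) * u.x := by rw [hx]; ring
  have hdy : u.y - L.y = -(L.colevel - 1) * u.y := by rw [hy]; ring
  rw [hda, hdx, hdy]
  have hnat : ((L.colevel - 1).natAbs : ℤ) = L.colevel - 1 := Int.natAbs_of_nonneg (by omega)
  have e2 : (1 - L.colevel).natAbs = (L.colevel - 1).natAbs := by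
    rw [← Int.natAbs_neg]; congr 1; ring
  rcases unit_coords hu1 with ⟨h0, h1 | h1⟩ | ⟨h0, h1 | h1⟩ <;>
    · rw [h0, h1]
      simp [Int.gcd_eq_natAbs, Nat.gcd_zero_right, e2, hnat]

/-! ## §2 Validity of the two functionals on a pair of unit slots (every height) -/

/-- (`e_A*` on `g`, `annU (c j)` on `j`), both units: value `−|β_j|² = −1`. -/
theorem fdetects_eA_annU_units {h : ℤ} (c : Cell) (g j : Fin 4) (hgA : (c g).OnAlphabet h) (hjA : (c j).OnAlphabet h)
    (hg1 : (c g).colevel = 1) (hj1 : (c j).colevel = 1) : FDetects eA (annU (c j)) (blockM₁ c g j) := by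
  have hga := level_eq hgA; have hja := level_eq hjA
  rw [hg1] at hga; rw [hj1] at hja
  have hsq : (c j).x * (c j).x + (c j).y * (c j).y = 1 := by
    rcases unit_coords hj1 with ⟨h0, h1 | h1⟩ | ⟨h0, h1 | h1⟩ <;> · rw [h0, h1]; norm_num
  unfold FDetects blockM₁ annU eA intG Letter.beta
  simp only [Matrix.of_apply, Matrix.cons_val', Matrix.cons_val_zero, Matrix.cons_val_one,
    Matrix.empty_val', Matrix.cons_val_fin_one, one_mul, zero_mul, add_zero]
  intro h0
  have := congrArg Zsqrtd.re h0
  simp [Zsqrtd.re_mul, Zsqrtd.re_add, Zsqrtd.star_mk] at this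
  nlinarith

/-- (`annU (c g)` on `g`, `e_A*` on `j`), both non-hub: value `−β_g·conj β_j ≠ 0`. -/
theorem fdetects_annU_eA (c : Cell) (g j : Fin 4) (hg : (c g).colevel ≠ 0) (hj : (c j).colevel ≠ 0) :
    FDetects (annU (c g)) eA (blockM₁ c g j) := by
  unfold FDetects blockM₁ annU eA
  simp only [Matrix.of_apply, Matrix.cons_val', Matrix.cons_val_zero, Matrix.cons_val_one,
    Matrix.empty_val', Matrix.cons_val_fin_one, mul_one, mul_zero, add_zero]
  refine mul_ne_zero (neg_ne_zero.mpr (beta_ne_zero_of_col_ne_zero hg)) ?_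
  intro hb
  apply beta_ne_zero_of_col_ne_zero hj
  have := congrArg star hb
  simpa using this

/-! ## §3 LEMMA B₄ — the mass row of an N u⁴ cell in an all-axis hub-free-P world -/

/-- `p` is an AXIS HOOK under `ν` at slot `g`: it agrees with `ν` off `g` and carries at `g` an axis letter one null step below `ν g`. -/
def IsAxisHook (p ν : Cell) (g : Fin 4) : Prop := (∀ t : Fin 4, t ≠ g → p t = ν t) ∧ NullStep (p g) (ν g) ∧ (p g).x * (p g).y = 0

private instance decNull (ℓ ℓ' : Letter) : Decidable (NullStep ℓ ℓ') := by unfold NullStep; infer_instance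
private instance decHook (p ν : Cell) (g : Fin 4) : Decidable (IsAxisHook p ν g) := by unfold IsAxisHook; infer_instance

/-- the `kFactor`-weighted P mass on the axis hooks under `ν` at slot `g`. -/
def hookMass (D : Design) (ν : Cell) (g : Fin 4) : ℤ :=
  (D.P.map fun pm => if IsAxisHook pm.1 ν g then kFactor (pm.1 g) (ν g) * (pm.2 : ℤ) else 0).sum

section
variable {h : ℤ} {D : Design}

private theorem sum_map_le {α : Type} (l : List α) (f g : α → ℤ) (hle : ∀ a ∈ l, f a ≤ g a) :
    (l.map f).sum ≤ (l.map g).sum := by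
  induction l with
  | nil => simp
  | cons a t ih =>
    simp only [List.map_cons, List.sum_cons]
    have h1 := hle a List.mem_cons_self
    have h2 := ih (fun b hb => hle b (List.mem_cons_of_mem a hb))
    omega

/-- `kFactor` of the zero difference is `1`. -/
theorem kFactor_self (ℓ : Letter) : kFactor ℓ ℓ = 1 := by
  unfold kFactor; simp

/-- `kFactor` of a null step is the (nonnegative) gcd. -/
theorem kFactor_nonneg_of_null {lo up : Letter} (hn : NullStep lo up) : 0 ≤ kFactor lo up := by
  unfold kFactor
  rw [if_neg (by intro hc; have := hn.1; omega), if_pos hn.2]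
  exact Int.natCast_nonneg _

/-- `homDim` of a single `g`-leg is the `kFactor` of that leg. -/
theorem homDim_leg {p ν : Cell} {g : Fin 4} (heq : ∀ t : Fin 4, t ≠ g → p t = ν t) (hn : NullStep (p g) (ν g)) :
    homDim p ν = kFactor (p g) (ν g) := by
  have hle : CellLe p ν := by
    intro f
    by_cases hf : f = g
    · subst hf; exact ⟨by have := hn.1; omega, le_of_eq hn.2⟩
    · rw [heq f hf]; simp
  unfold homDim
  rw [if_pos hle]
  rw [Finset.prod_eq_single g (fun f _ hf => by rw [heq f hf]; exact kFactor_self _) (fun hg => (hg (Finset.mem_univ g)).elim)]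

/-- a counted server below a u⁴ cell is hub-free (all co-levels `≠ 0`). -/
theorem counted_hubfree (hD : D.OnAlphabet h) {p ν : Cell} (hp : p ∈ D.suppN ++ D.suppP) (hν : ν ∈ D.suppN ++ D.suppP)
    (hu : ∀ f : Fin 4, (ν f).colevel = 1) {g j : Fin 4} {l m : Fin 2 → GaussianInt} (hc : DMassCounts p ν g j l m) :
    ∀ f : Fin 4, (p f).colevel ≠ 0 := by
  intro f
  have hpA := hD p hp f; have hνA := hD ν hν f
  have hpa := level_eq hpA; have hνa := level_eq hνA
  have below : p f = ν f ∨ NullStep (p f) (ν f) := by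
    rcases hc with heq | ⟨hleg, -⟩ | ⟨hleg, -⟩ | ⟨hr, -, -⟩
    · exact Or.inl (by rw [heq])
    · by_cases hf : f = g
      · subst hf; exact Or.inr hleg.1
      · exact Or.inl (hleg.2 f hf)
    · by_cases hf : f = j
      · subst hf; exact Or.inr hleg.1
      · exact Or.inl (hleg.2 f hf)
    · by_cases hfg : f = g
      · subst hfg; exact Or.inr hr.2.1
      by_cases hfj : f = j
      · subst hfj; exact Or.inr hr.2.2.1
      · exact Or.inl (hr.2.2.2 f hfg hfj)
  rcases below with he | hn
  · rw [he, hu f]; norm_num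
  · have := hn.1; have := hu f; omega

/-- **LEMMA B₄ (per cell, per slot).**  Behind the mass-form fine door on the N side (`DMassN`), with `Disj`, on the height-`h` alphabet, and in
a world where every hub-free supported P cell is an AXIS cell, every supported N cell `ν` all of whose letters are units satisfies, for every
slot `g`:  `m_N(ν) ≤ hookMass D ν g` — its multiplicity is at most the `kFactor`-weighted P mass sitting on the axis hooks directly below it
at `g`.  (Row: `e_A*` on `g`, `annU` on another unit slot `j`; every counted server is a hub-free P cell; the `j`-legs and (r2a) partners
carry an off-axis letter at `j` (`offAxis_of_not_annihilated`) and the off-axis `g`-legs one at `g`, so none of them is supported; the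
identical server is excluded by `Disj`; what remains are the axis `g`-legs, with `homDim = kFactor` of the leg.) -/
theorem u4_mass_le_hookMass (hD : D.OnAlphabet h) (hdisj : Disj D) (hmass : DMassN D)
    (hPax : ∀ p ∈ D.suppP, (∀ f : Fin 4, (p f).colevel ≠ 0) → ∀ f : Fin 4, (p f).x * (p f).y = 0)
    {ν : Cell} (hν : ν ∈ D.suppN) (hu : ∀ f : Fin 4, (ν f).colevel = 1) (g : Fin 4) :
    (D.mN ν : ℤ) ≤ hookMass D ν g := by
  have hνA : ∀ s : Fin 4, (ν s).OnAlphabet h := fun s => hD ν (mem_supp_of_memN D hν) s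
  obtain ⟨j, hgj⟩ : ∃ j : Fin 4, g ≠ j := ⟨g + 1, by
    intro hq; have := congrArg (fun t : Fin 4 => t - g) hq; simp at this⟩
  -- the valid row and its orientation: `l` sits on `min g j`, `m` on `max g j`; the annihilator `annU (ν j)` always on `j`
  have key : ∃ (a b : Fin 4) (l m : Fin 2 → GaussianInt), DMassValid ν a b l m ∧
      (∀ p : Cell, DMassCounts p ν a b l m → p ∈ D.suppP → IsAxisHook p ν g) := by
    rcases lt_or_gt_of_ne hgj with hlt | hlt
    · refine ⟨g, j, eA, annU (ν j), ⟨hlt, Or.inl (fdetects_eA_annU_units ν g j (hνA g) (hνA j) (hu g) (hu j))⟩, ?_⟩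
      intro p hc hp
      have hpA : ∀ s : Fin 4, (p s).OnAlphabet h := fun s => hD p (mem_supp_of_memP D hp) s
      have hfree := counted_hubfree hD (mem_supp_of_memP D hp) (mem_supp_of_memN D hν) hu hc
      have hax := hPax p hp hfree
      rcases hc with heq | ⟨hleg, -⟩ | ⟨hleg, hna⟩ | ⟨hr, -, hna⟩
      · exact (hdisj ν hν (heq ▸ hp)).elim
      · exact ⟨hleg.2, hleg.1, hax g⟩
      · exact (offAxis_of_not_annihilated (hpA j) (hνA j) (hu j) hleg.1 hna (hax j)).elim
      · exact (offAxis_of_not_annihilated (hpA j) (hνA j) (hu j) hr.2.2.1 hna (hax j)).elim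
    · refine ⟨j, g, annU (ν j), eA, ⟨hlt, Or.inl (fdetects_annU_eA ν j g (by rw [hu j]; norm_num) (by rw [hu g]; norm_num))⟩, ?_⟩
      intro p hc hp
      have hpA : ∀ s : Fin 4, (p s).OnAlphabet h := fun s => hD p (mem_supp_of_memP D hp) s
      have hfree := counted_hubfree hD (mem_supp_of_memP D hp) (mem_supp_of_memN D hν) hu hc
      have hax := hPax p hp hfree
      rcases hc with heq | ⟨hleg, hna⟩ | ⟨hleg, -⟩ | ⟨hr, hna, -⟩
      · exact (hdisj ν hν (heq ▸ hp)).elim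
      · exact (offAxis_of_not_annihilated (hpA j) (hνA j) (hu j) hleg.1 hna (hax j)).elim
      · exact ⟨hleg.2, hleg.1, hax g⟩
      · exact (offAxis_of_not_annihilated (hpA j) (hνA j) (hu j) hr.2.1 hna (hax j)).elim
  obtain ⟨a, b, l, m, hval, hhook⟩ := key
  have hrow := hmass ν hν a b l m hval
  refine le_trans hrow ?_
  unfold capN hookMass
  refine sum_map_le D.P _ _ fun pm hpm => ?_
  by_cases hc : DMassCounts pm.1 ν a b l m
  · rw [if_pos hc]
    by_cases hmpos : 0 < pm.2
    · have hp : pm.1 ∈ D.suppP := (mem_suppP_iff D pm.1).mpr ⟨pm.2, hpm, hmpos⟩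
      have hk := hhook pm.1 hc hp
      rw [if_pos hk, homDim_leg hk.1 hk.2.1]
    · have h0 : pm.2 = 0 := by omega
      rw [h0]; simp
  · rw [if_neg hc]
    by_cases hk : IsAxisHook pm.1 ν g
    · rw [if_pos hk]; exact mul_nonneg (kFactor_nonneg_of_null hk.2.1) (Int.natCast_nonneg _)
    · rw [if_neg hk]

/-- the weight in `hookMass` made explicit: an axis hook of co-level `k` at slot `g` is counted with `kFactor = k − 1`. -/
theorem hook_kFactor (hD : D.OnAlphabet h) {p ν : Cell} (hp : p ∈ D.suppP) (hν : ν ∈ D.suppN)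
    (hu : ∀ f : Fin 4, (ν f).colevel = 1) {g : Fin 4} (hk : IsAxisHook p ν g) :
    kFactor (p g) (ν g) = (p g).colevel - 1 :=
  kFactor_axis_below_unit (hD p (mem_supp_of_memP D hp) g) (hD ν (mem_supp_of_memN D hν) g) (hu g) hk.2.2 hk.2.1

/-- LEMMA B₄ with the P-side regime supplied by the N-side binder (M1)ₛ «every supported N cell has a co-level-0 letter» is VACUOUS (then no
u⁴ cell is supported); the regime hypothesis of `u4_mass_le_hookMass` is the one of the WEAK worlds where N u⁴ may live — stated here in
`ShellThreeFloorB ∕ BoxCap` words for the ledgers: «hub-free P all-axis» = `∀ p ∈ suppP, hub-free p → AxisCell p`. -/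
theorem u4_mass_le_hookMass' (hD : D.OnAlphabet h) (hdisj : Disj D) (hmass : DMassN D)
    (hPax : ∀ p ∈ D.suppP, (∀ f : Fin 4, (p f).colevel ≠ 0) → ∀ f : Fin 4, (p f).x = 0 ∨ (p f).y = 0)
    {ν : Cell} (hν : ν ∈ D.suppN) (hu : ∀ f : Fin 4, (ν f).colevel = 1) (g : Fin 4) :
    (D.mN ν : ℤ) ≤ hookMass D ν g :=
  u4_mass_le_hookMass hD hdisj hmass (fun p hp hfree f => mul_eq_zero.mpr (hPax p hp hfree f)) hν hu g

end

end Summit.HodgeConjecture.HodgeConjecture.Cruxes.BlochSeedDiscOne.FineMassU4
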